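import Summits.ABC.ABC.Theses.DefiniteXi
import Summits.ABC.ABC.Theorems.DefiniteXiDefiniteRTControlPrimeValTransport
import Summits.ABC.ABC.Theorems.SteinbergCore.Negative.SteinbergCoreDomain
import Literature.NumberTheory.Automorphic.ShimuraCurveRibetTakahashiBrandtCoordinatesProofs
import Literature.NumberTheory.EllipticCurves.IsogenyVariableChangeProofs
import Literature.NumberTheory.EllipticCurves.IsogenyCompProofs
import Literature.NumberTheory.EllipticCurves.IsogenyDualProofs
import Literature.NumberTheory.EllipticCurves.ModularDegreeMinimal
import Literature.NumberTheory.Sieve.PairShiu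
import HarnessLib

/-!
# Route DefiniteXi, crux `SteinbergCore` (stmt-ABC-15024), line `p6_tamagawa_split`: the definite
# comparison away from `6` at EVERY admissible quarantine `Nm` (stub `stub_xiDegreeComparison`),
# conditional on Takahashi's Thm. 2.3 for Shimura curves

The stub: for the Frey curve `E = freyCurve a b` of conductor `N`, every admissible `Nm` (odd,
squarefree, `ω(Nm)` odd, `Nm ∣ N`; possibly COMPOSITE), `ξ := brandtXi (N/Nm) Nm (a(E))`: a minimal
datum `D` of the model `freyCurve a b` exists and `cps ξ ≤ C_ε N^ε · cps (deg D) · T³`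
(`cps n = n / (2^{v₂ n} 3^{v₃ n})`, `T = ∏_{q ∣ N} v_q(Δ_min E)`).  Proved here CONDITIONALLY
(`xiDegreeComparison_of_facts`), in the sharper form `cps ξ ≤ 163^{ω(Nm)} ∏_{q ∣ Nm} v_q(Δ_min E) cps (deg D)`,
on (`hTlev`, `hT2`) **Takahashi 2001, Thm. 2.3 for the Shimura curve `X₀^D(M)`** at `p ∥ M` (level
side, Brandt type `(M/p, Dp)`: `X_p(J₀^D(M))` is the Brandt module of discriminant `Dp`, level `M/p` —
p. 84, Buzzard 1997 Thm. 4.7) and at `p ∣ D` (discriminant side with Thm. 3.2 (a), type `(pM, D/p)`),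
VERBATIM the hypotheses `hTlev`, `hT2` of the tree's
`Literature/NumberTheory/Automorphic/ShimuraCurveRibetTakahashiBrandtCoordinatesProofs.lean` (not yet
declarations of the tree; its fact `takahashi2001_thm_2_3_of_coprime` is the case `D = 1`) and exactly
what composite `Nm` needs (`brandtXi (N/Nm) Nm`, `ω(Nm) ≥ 3`, is the self-pairing `h_r` on
`X_r(J₀^{Nm/r}((N/Nm) r))`); on the named facts `PastenShimura2024_lemma_6_8` (via the landed
`stub_valTransport`), `nonempty_shimuraParametrizationData` (Jacquet–Langlands); and on `FreyModularity`.
Chain (`r ∣ Nm` prime, `P` class-minimal on `X₀^{Nm/r}(r N/Nm)`, `D₀` lattice-optimal, `deg D₀ ∣ deg D`):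
TOP `deg P · i = ξ j`, `i j = c_r(A) ≤ 163 c_r(E)`; STEP (`D = d·pr'`, Ribet–Takahashi Thm. 2 = Pasten
Prop. 6.13): `hTlev` on `X₀^d(pr'M)` at `p` and `hT2` on `X₀^D(M)` at `r'` share the Brandt type `(r'M, dp)`,
so `cps δ_D ≤ cps δ_d · 163² c_p(E) c_{r'}(E)`; BOTTOM `deg P = deg D₀` (`IsMinimalFor.deg_eq_modularDegree`).
Refs: [Takahashi2001] JNT 90, Thm. 2.3, 3.2 (a), p. 84; [PastenShimura2024] Lemma 6.8, Prop. 6.13, §6.9.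
-/

-- `Summit.<Summit>.<Problem>` is the mandated namespace; for the single-conjunct summit ABC the duplicate ABC.ABC is deliberate.
set_option linter.dupNamespace false

noncomputable section

namespace Summit.ABC.ABC.Theorems

open Summit.ABC.ABC.Theses.DefiniteXi
open Literature.NumberTheory.EllipticCurves Literature.NumberTheory.EllipticCurves.ModularForms
open Literature.NumberTheory.Automorphic
open WeierstrassCurve
open Summit.ABC.ABC.Theorems.SteinbergCore.Negative (primeToSix_mul primeToSix_le primeToSix_le_primeToSix_mul)

namespace XiDegreeComparison

/-- `cps m ≤ cps n` when `m ∣ n ≠ 0` (`cps` is multiplicative and `≥ 1` off `0`). [folklore] -/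
theorem primeToSix_le_of_dvd {m n : ℕ} (h : m ∣ n) (hn : n ≠ 0) :
    m / (ordProj[2] m * ordProj[3] m) ≤ n / (ordProj[2] n * ordProj[3] n) := by
  obtain ⟨k, rfl⟩ := h
  exact primeToSix_le_primeToSix_mul (right_ne_zero_of_mul hn)

/-- `cps (m k) ≤ cps m · k`. [folklore] -/
theorem primeToSix_mul_le (m k : ℕ) :
    m * k / (ordProj[2] (m * k) * ordProj[3] (m * k)) ≤ m / (ordProj[2] m * ordProj[3] m) * k := by
  rw [primeToSix_mul]; exact Nat.mul_le_mul_left _ (primeToSix_le k)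

/-- **The top step in `ℕ`.** From Takahashi's system `δ i = ξ j`, `i j = c`, `0 < δ`, `0 < i`:
`cps ξ ≤ cps δ · c` (`j ≥ 1`, `cps (ξ j) = cps (δ i) ≤ cps δ · i ≤ cps δ · c`).
[cite: Takahashi2001, Thm. 2.3 (p. 79)] -/
theorem primeToSix_le_of_level_system {δ ξ i j c : ℕ} (hδ : 0 < δ) (hi : 0 < i)
    (hc : i * j = c) (h : δ * i = ξ * j) :
    ξ / (ordProj[2] ξ * ordProj[3] ξ) ≤ δ / (ordProj[2] δ * ordProj[3] δ) * c := by
  obtain ⟨hj, -⟩ := pos_of_thm_2_3 hδ hi h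
  calc ξ / (ordProj[2] ξ * ordProj[3] ξ)
      ≤ ξ * j / (ordProj[2] (ξ * j) * ordProj[3] (ξ * j)) := primeToSix_le_primeToSix_mul hj.ne'
    _ = δ * i / (ordProj[2] (δ * i) * ordProj[3] (δ * i)) := by rw [h]
    _ ≤ δ / (ordProj[2] δ * ordProj[3] δ) * i := primeToSix_mul_le δ i
    _ ≤ δ / (ordProj[2] δ * ordProj[3] δ) * c :=
        Nat.mul_le_mul_left _ (hc ▸ Nat.le_mul_of_pos_right _ hj)

/-- **The two-prime step in `ℕ`** (Ribet–Takahashi's Thm. 2 = Pasten's Prop. 6.13 in Brandt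
coordinates, prime-to-`6`): the level system `δ₁ i₁ = h j₁`, `i₁ j₁ = c₁` and the discriminant
system `δ₂ i₂ = h j₂`, `i₂ j₂ = c₂` with the SAME `h` give `δ₂ (i₂ j₁) = δ₁ (i₁ j₂)`, whence
`cps δ₂ ≤ cps δ₁ · c₁ c₂`.
[cite: Takahashi2001, Thm. 2.3 (p. 79) and Thm. 3.2 (a) (p. 82)] [cite: PastenShimura2024, Prop. 6.13 p. 23] -/
theorem primeToSix_le_of_two_systems {δ₁ δ₂ h i₁ j₁ i₂ j₂ c₁ c₂ : ℕ} (hδ₁ : 0 < δ₁)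
    (hi₁ : 0 < i₁) (hi₂ : 0 < i₂) (hc₁ : i₁ * j₁ = c₁) (hc₂ : i₂ * j₂ = c₂)
    (h₁ : δ₁ * i₁ = h * j₁) (h₂ : δ₂ * i₂ = h * j₂) :
    δ₂ / (ordProj[2] δ₂ * ordProj[3] δ₂) ≤ δ₁ / (ordProj[2] δ₁ * ordProj[3] δ₁) * (c₁ * c₂) := by
  obtain ⟨hj₁, -⟩ := pos_of_thm_2_3 hδ₁ hi₁ h₁
  have key : δ₂ * (i₂ * j₁) = δ₁ * (i₁ * j₂) := by
    calc δ₂ * (i₂ * j₁) = δ₂ * i₂ * j₁ := by ring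
      _ = h * j₁ * j₂ := by rw [h₂]; ring
      _ = δ₁ * (i₁ * j₂) := by rw [← h₁]; ring
  have hi₁c : i₁ ≤ c₁ := hc₁ ▸ Nat.le_mul_of_pos_right _ hj₁
  have hj₂c : j₂ ≤ c₂ := hc₂ ▸ Nat.le_mul_of_pos_left _ hi₂
  calc δ₂ / (ordProj[2] δ₂ * ordProj[3] δ₂)
      ≤ δ₂ * (i₂ * j₁) / (ordProj[2] (δ₂ * (i₂ * j₁)) * ordProj[3] (δ₂ * (i₂ * j₁))) :=
        primeToSix_le_primeToSix_mul (Nat.mul_ne_zero hi₂.ne' hj₁.ne')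
    _ = δ₁ * (i₁ * j₂) / (ordProj[2] (δ₁ * (i₁ * j₂)) * ordProj[3] (δ₁ * (i₁ * j₂))) := by rw [key]
    _ ≤ δ₁ / (ordProj[2] δ₁ * ordProj[3] δ₁) * (i₁ * j₂) := primeToSix_mul_le _ _
    _ ≤ δ₁ / (ordProj[2] δ₁ * ordProj[3] δ₁) * (c₁ * c₂) :=
        Nat.mul_le_mul_left _ (Nat.mul_le_mul hi₁c hj₂c)

/-- **`163^{ω(n)} ≤ C_ε n^ε`** (the divisor bound: `163 ≤ 2⁸` and `2^{ω(n)} ≤ τ(n) ≪_ε n^ε`,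
tree `PairShiu.exists_two_pow_card_primeFactors_le`). [folklore] -/
theorem exists_pow_card_primeFactors_le {ε : ℝ} (hε : 0 < ε) :
    ∃ C : ℝ, 0 ≤ C ∧ ∀ n : ℕ, 1 ≤ n → (163 : ℝ) ^ n.primeFactors.card ≤ C * (n : ℝ) ^ ε := by
  obtain ⟨C, hC1, hC⟩ := Literature.NumberTheory.Sieve.PairShiu.exists_two_pow_card_primeFactors_le
    (show (0 : ℝ) < ε / 8 by positivity)
  refine ⟨C ^ 8, by positivity, fun n hn => ?_⟩
  have h2 : (0 : ℝ) ≤ (2 : ℝ) ^ n.primeFactors.card := by positivity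
  calc (163 : ℝ) ^ n.primeFactors.card ≤ ((2 : ℝ) ^ 8) ^ n.primeFactors.card :=
        pow_le_pow_left₀ (by norm_num) (by norm_num) _
    _ = ((2 : ℝ) ^ n.primeFactors.card) ^ 8 := by rw [← pow_mul, mul_comm, pow_mul]
    _ ≤ (C * (n : ℝ) ^ (ε / 8)) ^ 8 := pow_le_pow_left₀ h2 (hC n hn) 8
    _ = C ^ 8 * ((n : ℝ) ^ (ε / 8)) ^ 8 := mul_pow _ _ _
    _ = C ^ 8 * (n : ℝ) ^ ε := by rw [← Real.rpow_mul_natCast (Nat.cast_nonneg _)]; norm_num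

/-- **The telescoping (Pasten §6.9 in Brandt coordinates, prime-to-`6`).** Under `hTlev`, `hT2`
(Takahashi's Thm. 2.3 for `X₀^D(M)` at `p ∥ M` / `p ∣ D`, verbatim those of
`ShimuraCurveRibetTakahashiBrandtCoordinatesProofs.lean`), Lemma 6.8 and Jacquet–Langlands data: for a
global minimal model `W ∼ E`, the class-minimal classical datum `D₀` and every admissible `N = DM`, `D` odd,
`ω(D) = 2n`, a class-minimal Shimura datum `P` on `X₀^D(M)` has
`cps (deg P) ≤ (163²)^n · ∏_{q ∣ D} v_q(Δ_min E) · cps (deg D₀)` (induction on `n`, module docstring).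
[cite: PastenShimura2024, §6.9 p. 25 and Prop. 6.13 p. 23] [cite: Takahashi2001, Thm. 2.3 (p. 79), Thm. 3.2 (a) (p. 82), p. 84] -/
theorem primeToSix_deg_le_telescope
    (hTlev : ∀ {N D M p m : ℕ}, p.Prime → M = p * m → ¬ p ∣ m → IsAdmissibleFactorization N D M →
      ∀ (X : ShimuraCurveData D M) (W : WeierstrassCurve ℚ) [W.IsElliptic], W.conductorNorm ℤ = N →
      ∀ (W' : WeierstrassCurve ℚ) [W'.IsElliptic] (P : ShimuraParametrizationData X W'),
        P.IsMinimalFor W →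
      ∀ S : Brandt.XiSetup m (D * p),
        ∃ i j : ℕ, 0 < i ∧ i * j = (W'.minimalDiscriminantNorm ℤ).factorization p ∧
          i ∣ S.xi (fun n => W'.LFunction n) ∧ P.deg * i = S.xi (fun n => W'.LFunction n) * j)
    (hT2 : ∀ {N D M p d : ℕ}, p.Prime → D = p * d → IsAdmissibleFactorization N D M →
      ∀ (X : ShimuraCurveData D M) (W : WeierstrassCurve ℚ) [W.IsElliptic], W.conductorNorm ℤ = N →
      ∀ (W' : WeierstrassCurve ℚ) [W'.IsElliptic] (P : ShimuraParametrizationData X W'),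
        P.IsMinimalFor W →
      ∀ S : Brandt.XiSetup (p * M) d,
        ∃ i j : ℕ, 0 < i ∧ i * j = (W'.minimalDiscriminantNorm ℤ).factorization p ∧
          i ∣ S.xi (fun n => W'.LFunction n) ∧ P.deg * i = S.xi (fun n => W'.LFunction n) * j)
    (h68 : PastenShimura2024_lemma_6_8) (hJL : nonempty_shimuraParametrizationData)
    {a b : ℤ} (hab : IsCoprime a b) (h0 : a * b * (a + b) ≠ 0) {N : ℕ} [NeZero N]
    (hN : (freyCurve a b).conductorNorm ℤ = N)
    (W : WeierstrassCurve ℚ) [W.IsElliptic] [W.IsGloballyMinimal] (hWN : W.conductorNorm ℤ = N)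
    (hEW : (freyCurve a b).IsIsogenous W)
    {W₀ : WeierstrassCurve ℚ} [W₀.IsElliptic] (D₀ : ModularParametrizationData W₀ N)
    (hf₀ : IsNewformOf W D₀.f)
    (hmin₀ : ∀ (W₂ : WeierstrassCurve ℚ) [W₂.IsElliptic] (D₂ : ModularParametrizationData W₂ N),
      D₂.f = D₀.f → D₀.modularDegree ≤ D₂.modularDegree) :
    ∀ (n : ℕ) {D M : ℕ}, IsAdmissibleFactorization N D M → D.primeFactors.card = 2 * n →
      ¬ 2 ∣ D →
    ∀ (X : ShimuraCurveData D M) (W' : WeierstrassCurve ℚ) [W'.IsElliptic]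
      (P : ShimuraParametrizationData X W'), P.IsMinimalFor W →
      P.deg / (ordProj[2] P.deg * ordProj[3] P.deg) ≤
        (163 * 163) ^ n *
          (∏ q ∈ D.primeFactors, ((freyCurve a b).minimalDiscriminantNorm ℤ).factorization q) *
          (D₀.modularDegree / (ordProj[2] D₀.modularDegree * ordProj[3] D₀.modularDegree)) := by
  haveI := isElliptic_freyCurve h0
  intro n
  induction n with
  | zero =>
    intro D M hadm hcard _ X W' _ P hP
    have h1 : D.primeFactors = ∅ := Finset.card_eq_zero.mp (by omega)
    have hD : D = 1 := (Nat.primeFactors_eq_empty.mp h1).resolve_left hadm.squarefree.ne_zero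
    subst hD
    obtain rfl : M = N := by simpa using hadm.mul_eq
    simp [hP.deg_eq_modularDegree D₀ hf₀ hmin₀]
  | succ n ih =>
    intro D M hadm hcard hD2 X W' _ P hP
    -- two primes `p ≠ r` of `D`, `d = D/(pr)`
    obtain ⟨p, hp⟩ : D.primeFactors.Nonempty := Finset.card_pos.mp (by omega)
    obtain ⟨r, hr⟩ : (D.primeFactors.erase p).Nonempty :=
      Finset.card_pos.mp (by rw [Finset.card_erase_of_mem hp]; omega)
    obtain ⟨hrp, hr⟩ := Finset.mem_erase.mp hr
    have hpp := Nat.prime_of_mem_primeFactors hp; have hrr := Nat.prime_of_mem_primeFactors hr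
    have hpD := Nat.dvd_of_mem_primeFactors hp; have hrD := Nat.dvd_of_mem_primeFactors hr
    obtain ⟨hDd, hadm₁, hdisj, hpf⟩ := hadm.erase_two_primes hpp hrr (Ne.symm hrp) hpD hrD
    set d := D / (p * r) with hd
    have hcard₁ : d.primeFactors.card = 2 * n := by
      have : D.primeFactors.card = d.primeFactors.card + 2 := by
        rw [hpf, Finset.card_union_of_disjoint hdisj, Finset.card_pair (Ne.symm hrp)]
      omega
    have hd2 : ¬ 2 ∣ d := fun h2 => hD2 (h2.trans ⟨p * r, hDd⟩)
    have hDN : D ∣ (freyCurve a b).conductorNorm ℤ := by rw [hN]; exact ⟨M, hadm.mul_eq.symm⟩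
    have hp2 : p ≠ 2 := fun h => hD2 (h ▸ hpD)
    have hr2 : r ≠ 2 := fun h => hD2 (h ▸ hrD)
    -- the curve `X₀^d(prM)` and a class-minimal datum `P₁` on it; induction hypothesis
    obtain ⟨X₁⟩ := nonempty_shimuraCurveData_holds hadm₁
    obtain ⟨W₁', hW₁', P₁, hP₁⟩ :=
      ShimuraParametrizationData.exists_isMinimalFor_of_nonempty (hJL hadm₁ X₁ W hWN)
    have ih₁ := ih hadm₁ hcard₁ hd2 X₁ W₁' P₁ hP₁
    -- the common Brandt setup of type `(r M, d p)`; level side at `p`, discriminant side at `r`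
    have hDr : D = r * (d * p) := by rw [hDd]; ring
    obtain ⟨S⟩ := hadm.nonempty_xiSetup_disc hrr hDr
    have hpm : ¬ p ∣ r * M := (Nat.Prime.coprime_iff_not_dvd hpp).mp (Nat.Coprime.mul_right
      ((Nat.coprime_primes hpp hrr).mpr (Ne.symm hrp)) (Nat.Coprime.coprime_dvd_left hpD hadm.coprime))
    obtain ⟨i₁, j₁, hi₁, hc₁, -, hδ₁⟩ :=
      hTlev hpp (by ring : p * r * M = p * (r * M)) hpm hadm₁ X₁ W hWN W₁' P₁ hP₁ S
    obtain ⟨i₂, j₂, hi₂, hc₂, -, hδ₂⟩ := hT2 hrr hDr hadm X W hWN W' P hP S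
    -- the same eigenvalues `a(W₁') = a(W) = a(W')`, and the step in `ℕ`
    have hL₁ : (fun n => W₁'.LFunction n) = fun n => W.LFunction n := by
      funext n; rw [hP₁.1.LFunction_eq]
    have hL₂ : (fun n => W'.LFunction n) = fun n => W.LFunction n := by
      funext n; rw [hP.1.LFunction_eq]
    rw [hL₁] at hδ₁; rw [hL₂] at hδ₂
    have hstep := primeToSix_le_of_two_systems P₁.deg_pos hi₁ hi₂ hc₁ hc₂ hδ₁ hδ₂
    -- `c_p(A₁) ≤ 163 c_p(E)`, `c_r(A₂) ≤ 163 c_r(E)` (Pasten Lemma 6.8)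
    have hvp := DefiniteRTControlPrime.stub_valTransport h68 a b hab h0 p hpp hp2 (hpD.trans hDN)
      W₁' (hEW.trans' hP₁.1)
    have hvr := DefiniteRTControlPrime.stub_valTransport h68 a b hab h0 r hrr hr2 (hrD.trans hDN)
      W' (hEW.trans' hP.1)
    -- assemble
    set V := ∏ q ∈ d.primeFactors, ((freyCurve a b).minimalDiscriminantNorm ℤ).factorization q
    set vp := ((freyCurve a b).minimalDiscriminantNorm ℤ).factorization p
    set vr := ((freyCurve a b).minimalDiscriminantNorm ℤ).factorization r
    set c₀ := D₀.modularDegree / (ordProj[2] D₀.modularDegree * ordProj[3] D₀.modularDegree)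
    have hprod : ∏ q ∈ D.primeFactors, ((freyCurve a b).minimalDiscriminantNorm ℤ).factorization q
        = V * (vp * vr) := by
      rw [hpf, Finset.prod_union hdisj, Finset.prod_pair (Ne.symm hrp)]
    rw [hprod]
    calc P.deg / (ordProj[2] P.deg * ordProj[3] P.deg)
        ≤ P₁.deg / (ordProj[2] P₁.deg * ordProj[3] P₁.deg) *
            ((W₁'.minimalDiscriminantNorm ℤ).factorization p *
              (W'.minimalDiscriminantNorm ℤ).factorization r) := hstep
      _ ≤ (163 * 163) ^ n * V * c₀ * ((163 * vp) * (163 * vr)) :=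
          Nat.mul_le_mul ih₁ (Nat.mul_le_mul hvp hvr)
      _ = (163 * 163) ^ (n + 1) * (V * (vp * vr)) * c₀ := by ring

end XiDegreeComparison

open XiDegreeComparison

/-- **`stub_xiDegreeComparison` of line `p6_tamagawa_split` at EVERY admissible (possibly composite)
`Nm`, conditionally** on: Takahashi 2001 Thm. 2.3 for Shimura curves (`hTlev`, `hT2`, verbatim the
hypotheses of `ShimuraCurveRibetTakahashiBrandtCoordinatesProofs.lean`, not yet named facts of the tree),
`PastenShimura2024_lemma_6_8`, `nonempty_shimuraParametrizationData` (Jacquet–Langlands) and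
`FreyModularity`; in fact `cps ξ ≤ 163^{ω(Nm)} · ∏_{q ∣ Nm} v_q(Δ_min E) · cps (deg D)` (module docstring).
[cite: Takahashi2001, Thm. 2.3 (p. 79), Thm. 3.2 (a) (p. 82), proof of Thm. 3.8 (p. 84)]
[cite: PastenShimura2024, Lemma 6.8 p. 22, Prop. 6.13 p. 23, §6.9 p. 25] -/
theorem xiDegreeComparison_of_facts :
    (∀ {N D M p m : ℕ}, p.Prime → M = p * m → ¬ p ∣ m →
      Literature.NumberTheory.Automorphic.IsAdmissibleFactorization N D M →
      ∀ (X : Literature.NumberTheory.Automorphic.ShimuraCurveData D M) (W : WeierstrassCurve ℚ)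
        [W.IsElliptic], W.conductorNorm ℤ = N →
      ∀ (W' : WeierstrassCurve ℚ) [W'.IsElliptic]
        (P : Literature.NumberTheory.Automorphic.ShimuraParametrizationData X W'),
        P.IsMinimalFor W →
      ∀ S : Literature.NumberTheory.Automorphic.Brandt.XiSetup m (D * p),
        ∃ i j : ℕ, 0 < i ∧ i * j = (W'.minimalDiscriminantNorm ℤ).factorization p ∧
          i ∣ S.xi (fun n => W'.LFunction n) ∧
          P.deg * i = S.xi (fun n => W'.LFunction n) * j) →
    (∀ {N D M p d : ℕ}, p.Prime → D = p * d →
      Literature.NumberTheory.Automorphic.IsAdmissibleFactorization N D M →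
      ∀ (X : Literature.NumberTheory.Automorphic.ShimuraCurveData D M) (W : WeierstrassCurve ℚ)
        [W.IsElliptic], W.conductorNorm ℤ = N →
      ∀ (W' : WeierstrassCurve ℚ) [W'.IsElliptic]
        (P : Literature.NumberTheory.Automorphic.ShimuraParametrizationData X W'),
        P.IsMinimalFor W →
      ∀ S : Literature.NumberTheory.Automorphic.Brandt.XiSetup (p * M) d,
        ∃ i j : ℕ, 0 < i ∧ i * j = (W'.minimalDiscriminantNorm ℤ).factorization p ∧
          i ∣ S.xi (fun n => W'.LFunction n) ∧
          P.deg * i = S.xi (fun n => W'.LFunction n) * j) →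
    Literature.NumberTheory.EllipticCurves.ModularForms.PastenShimura2024_lemma_6_8 →
    Literature.NumberTheory.Automorphic.nonempty_shimuraParametrizationData →
    Summit.ABC.ABC.Theses.DefiniteXi.FreyModularity →
    ∀ ε : ℝ, 0 < ε → ∃ C : ℝ, ∀ a b : ℤ, IsCoprime a b → a * b * (a + b) ≠ 0 → ∀ (N : ℕ) [NeZero N],
      (Literature.NumberTheory.EllipticCurves.freyCurve a b).conductorNorm ℤ = N →
      ∀ Nm : ℕ, Odd Nm → Squarefree Nm → Odd Nm.primeFactors.card → Nm ∣ N →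
      Literature.NumberTheory.Automorphic.brandtXi (N / Nm) Nm
          (fun n => (Literature.NumberTheory.EllipticCurves.freyCurve a b).LFunction n) ≠ 0 →
      ∃ D : Literature.NumberTheory.EllipticCurves.ModularForms.ModularParametrizationData
        (Literature.NumberTheory.EllipticCurves.freyCurve a b) N,
        (∀ D' : Literature.NumberTheory.EllipticCurves.ModularForms.ModularParametrizationData
          (Literature.NumberTheory.EllipticCurves.freyCurve a b) N, D.deg ≤ D'.deg) ∧
        ((Literature.NumberTheory.Automorphic.brandtXi (N / Nm) Nm
              (fun n => (Literature.NumberTheory.EllipticCurves.freyCurve a b).LFunction n) /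
            (ordProj[2] (Literature.NumberTheory.Automorphic.brandtXi (N / Nm) Nm
                (fun n => (Literature.NumberTheory.EllipticCurves.freyCurve a b).LFunction n)) *
              ordProj[3] (Literature.NumberTheory.Automorphic.brandtXi (N / Nm) Nm
                (fun n => (Literature.NumberTheory.EllipticCurves.freyCurve a b).LFunction n))) : ℕ) : ℝ) ≤
          C * (N : ℝ) ^ ε * ((D.deg / (ordProj[2] D.deg * ordProj[3] D.deg) : ℕ) : ℝ) *
            ((∏ q ∈ N.primeFactors, ((Literature.NumberTheory.EllipticCurves.freyCurve a b).minimalDiscriminantNorm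
              ℤ).factorization q : ℕ) : ℝ) ^ 3 := by
  intro hTlev hT2 h68 hJL hMod ε hε
  obtain ⟨C, hC0, hC⟩ := exists_pow_card_primeFactors_le hε
  refine ⟨C, fun a b hab h0 N _ hN Nm hodd hsq hcard hNmN _hξ => ?_⟩
  haveI := isElliptic_freyCurve h0
  -- the minimal datum `D` of the Frey model; the lattice-optimal datum `D₀`, `deg D₀ ∣ deg D`
  obtain ⟨D, -, hDmin⟩ := exists_minimal_datum (hMod a b hab h0 N hN)
  refine ⟨D, fun D' => hDmin D', ?_⟩
  obtain ⟨W₀, hW₀, D₀, hf₀, h₀⟩ := D.exists_optimalDatum'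
  haveI := hW₀
  have hker₀ : D₀.isogenyMap.ker = ⊥ := D₀.isogenyMap_ker_eq_bot_iff.mpr h₀
  have hmin₀ : ∀ (W₂ : WeierstrassCurve ℚ) [W₂.IsElliptic] (D₂ : ModularParametrizationData W₂ N),
      D₂.f = D₀.f → D₀.modularDegree ≤ D₂.modularDegree := fun W₂ _ D₂ hD₂ =>
    D₀.modularDegree_le_of_isogenyMap_ker_eq_bot hker₀ D₂ hD₂
  have hdvd : D₀.modularDegree ∣ D.deg := by
    have hinj : Function.Injective D₀.isogenyMap := (AddMonoidHom.ker_eq_bot_iff _).mp hker₀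
    obtain ⟨_, hdeg⟩ := D.modularDegree_eq_card_ker_mul hf₀.symm D₀.smul_periodLattice_le hinj
      D₀.deg_pos D₀.finite_setOf_natCard_fiberOrbits_ne
    exact ⟨_, hdeg.trans (mul_comm _ _)⟩
  -- a global minimal model `W = Cv • E` of the Frey curve
  obtain ⟨Cv, hCv⟩ := hasGlobalMinimalModel_rat_holds (freyCurve a b)
  haveI := hCv
  have hWN : (Cv • freyCurve a b).conductorNorm ℤ = N := by rw [conductorNorm_smul_rat, hN]
  have hEW : (freyCurve a b).IsIsogenous (Cv • freyCurve a b) := isIsogenous_smul _ Cv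
  have hfW : IsNewformOf (Cv • freyCurve a b) D₀.f := by
    rw [hf₀]; exact D.isNewformOf.of_isIsogenous hEW.symm_of_charZero
  -- a Brandt setup of type `(N/Nm, Nm)` exists on the domain; a prime `r ∣ Nm`; admissibility
  obtain ⟨S₀⟩ : Nonempty (Brandt.XiSetup (N / Nm) Nm) := by
    have h := XiBound.Negative.nonempty_xiSetup_freyCurve hab h0 hodd hsq hcard (hN ▸ hNmN)
    rwa [hN] at h
  obtain ⟨-, -, -, hcop⟩ := Brandt.nonempty_xiSetup_iff_admissible.mp ⟨S₀⟩
  have hNm1 : Nm ≠ 1 := by rintro rfl; simp at hcard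
  obtain ⟨r, hr, hrNm⟩ := Nat.exists_prime_and_dvd hNm1
  set Np := N / Nm with hNp
  set D' := Nm / r with hD'
  have hNmr : D' * r = Nm := Nat.div_mul_cancel hrNm
  have hN' : Np * Nm = N := Nat.div_mul_cancel hNmN
  obtain ⟨hD'r, hsqD', -⟩ : D'.Coprime r ∧ Squarefree D' ∧ Squarefree r := by
    rw [← Nat.squarefree_mul_iff, hNmr]; exact hsq
  have hpfNm : Nm.primeFactors = D'.primeFactors ∪ {r} := by
    rw [← hNmr, hD'r.primeFactors_mul, hr.primeFactors]
  have hdisj : Disjoint D'.primeFactors {r} := hr.primeFactors ▸ hD'r.disjoint_primeFactors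
  have hcardNm : Nm.primeFactors.card = D'.primeFactors.card + 1 := by
    rw [hpfNm, Finset.card_union_of_disjoint hdisj, Finset.card_singleton]
  obtain ⟨k, hk⟩ : Even D'.primeFactors.card := hcard.elim fun m hm => ⟨m, by omega⟩
  have hadm : IsAdmissibleFactorization N D' (r * Np) :=
    ⟨NeZero.pos N, by rw [← hN', ← hNmr]; ring, hsqD', ⟨k, hk⟩,
      Nat.Coprime.mul_right hD'r (hcop.symm.coprime_dvd_left (Nat.div_dvd_of_dvd hrNm))⟩
  have hrNp : ¬ r ∣ Np :=
    (Nat.Prime.coprime_iff_not_dvd hr).mp (Nat.Coprime.coprime_dvd_left hrNm hcop.symm)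
  -- the Shimura curve `X₀^{D'}(M')` and a class-minimal datum `P` of `W` on it
  obtain ⟨X⟩ := nonempty_shimuraCurveData_holds hadm
  obtain ⟨W', hW', P, hP⟩ := ShimuraParametrizationData.exists_isMinimalFor_of_nonempty
    (hJL hadm X (Cv • freyCurve a b) hWN)
  haveI := hW'
  -- TOP: Thm. 2.3 on `X₀^{D'}(M')` at `r ∥ M'`, Brandt type `(Np, D' r) = (Np, Nm)`
  have key : ∀ K : ℕ, D' * r = K → ∀ S : Brandt.XiSetup Np K, ∃ i j : ℕ, 0 < i ∧
      i * j = (W'.minimalDiscriminantNorm ℤ).factorization r ∧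
      P.deg * i = brandtXi Np K (fun n => W'.LFunction n) * j := by
    intro K hK S; subst hK
    obtain ⟨i, j, hi, hc, -, hδ⟩ := hTlev hr rfl hrNp hadm X (Cv • freyCurve a b) hWN W' P hP S
    exact ⟨i, j, hi, hc, by rw [S.brandtXi_eq_xi]; exact hδ⟩
  obtain ⟨i, j, hi, hc, hδ⟩ := key Nm hNmr S₀
  have hL : (fun n => W'.LFunction n) = fun n => (freyCurve a b).LFunction n := by
    funext n; rw [(hEW.trans' hP.1).LFunction_eq]
  rw [hL] at hδ
  set ξ := brandtXi Np Nm (fun n => (freyCurve a b).LFunction n) with hξ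
  have htop := primeToSix_le_of_level_system P.deg_pos hi hc hδ
  have hr2 : r ≠ 2 := fun h => (Nat.not_even_iff_odd.mpr hodd) (even_iff_two_dvd.mpr (h ▸ hrNm))
  have hrN : r ∣ (freyCurve a b).conductorNorm ℤ := by rw [hN]; exact hrNm.trans hNmN
  have hvr := DefiniteRTControlPrime.stub_valTransport h68 a b hab h0 r hr hr2 hrN W'
    (hEW.trans' hP.1)
  -- TELESCOPE down to `(1, N)`
  have hD'2 : ¬ 2 ∣ D' := fun h =>
    (Nat.not_even_iff_odd.mpr hodd) (even_iff_two_dvd.mpr (h.trans (Nat.div_dvd_of_dvd hrNm)))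
  have htel := primeToSix_deg_le_telescope hTlev hT2 h68 hJL hab h0 hN (Cv • freyCurve a b) hWN
    hEW D₀ hfW hmin₀ k hadm (by omega) hD'2 X W' P hP
  -- the chain in `ℕ`
  set V' := ∏ q ∈ D'.primeFactors, ((freyCurve a b).minimalDiscriminantNorm ℤ).factorization q
  set vr := ((freyCurve a b).minimalDiscriminantNorm ℤ).factorization r
  set TNm := ∏ q ∈ Nm.primeFactors, ((freyCurve a b).minimalDiscriminantNorm ℤ).factorization q
    with hTNm
  set T := ∏ q ∈ N.primeFactors, ((freyCurve a b).minimalDiscriminantNorm ℤ).factorization q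
  set c₀ := D₀.modularDegree / (ordProj[2] D₀.modularDegree * ordProj[3] D₀.modularDegree)
  set cD := D.deg / (ordProj[2] D.deg * ordProj[3] D.deg)
  have hTNm_eq : TNm = V' * vr := by
    rw [hTNm, hpfNm, Finset.prod_union hdisj, Finset.prod_singleton]
  have hc₀D : c₀ ≤ cD := primeToSix_le_of_dvd hdvd D.deg_pos.ne'
  have hchain : ξ / (ordProj[2] ξ * ordProj[3] ξ) ≤ 163 ^ Nm.primeFactors.card * (TNm * cD) :=
    calc ξ / (ordProj[2] ξ * ordProj[3] ξ)
        ≤ P.deg / (ordProj[2] P.deg * ordProj[3] P.deg) *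
            (W'.minimalDiscriminantNorm ℤ).factorization r := htop
      _ ≤ (163 * 163) ^ k * V' * c₀ * (163 * vr) := Nat.mul_le_mul htel hvr
      _ ≤ (163 * 163) ^ k * V' * cD * (163 * vr) :=
          Nat.mul_le_mul_right _ (Nat.mul_le_mul_left _ hc₀D)
      _ = 163 ^ (k + k + 1) * ((V' * vr) * cD) := by
          rw [show (163 * 163 : ℕ) ^ k = 163 ^ (k + k) by rw [mul_pow, ← pow_add]]; ring
      _ = 163 ^ Nm.primeFactors.card * (TNm * cD) := by rw [hcardNm, hk, hTNm_eq]
  -- `∏_{q ∣ Nm} v_q ≤ T ≤ T³` and `163^{ω(Nm)} ≤ 163^{ω(N)} ≤ C N^ε`; to `ℝ`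
  have hone : ∀ q ∈ N.primeFactors, 1 ≤ ((freyCurve a b).minimalDiscriminantNorm ℤ).factorization q :=
    fun q hq => factorization_minimalDiscriminantNorm_pos_of_dvd (freyCurve a b)
      (Nat.prime_of_mem_primeFactors hq) (hN ▸ Nat.dvd_of_mem_primeFactors hq)
  have hsub : Nm.primeFactors ⊆ N.primeFactors := Nat.primeFactors_mono hNmN (NeZero.ne N)
  have hTNmT : TNm ≤ T ^ 3 :=
    (Finset.prod_le_prod_of_subset_of_one_le' hsub fun q hq _ => hone q hq).trans
      (Nat.le_self_pow (by norm_num) T)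
  have h163 : (163 : ℝ) ^ Nm.primeFactors.card ≤ C * (N : ℝ) ^ ε :=
    (pow_le_pow_right₀ (by norm_num) (Finset.card_le_card hsub)).trans
      (hC N (Nat.one_le_iff_ne_zero.mpr (NeZero.ne N)))
  have hTNm3 : (TNm : ℝ) ≤ (T : ℝ) ^ 3 := by exact_mod_cast hTNmT
  calc ((ξ / (ordProj[2] ξ * ordProj[3] ξ) : ℕ) : ℝ)
      ≤ (163 : ℝ) ^ Nm.primeFactors.card * ((TNm : ℝ) * (cD : ℝ)) := by exact_mod_cast hchain
    _ ≤ (C * (N : ℝ) ^ ε) * (((T : ℝ) ^ 3) * (cD : ℝ)) := by gcongr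
    _ = C * (N : ℝ) ^ ε * (cD : ℝ) * (T : ℝ) ^ 3 := by ring

end Summit.ABC.ABC.Theorems

end
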